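import Literature.NumberTheory.Automorphic.TameLevelHeckeNilpotent
import Literature.NumberTheory.Automorphic.ResGLnAdelicCoefficients
import Literature.NumberTheory.Automorphic.OrdinaryCompletedCohomologyGL
import HarnessLib

/-!
# The generators of `𝕋(K^p)`, their Hecke data, and the character `x₀` on the dense subring

Topic `NumberTheory/Automorphic`; namespace `Literature.NumberTheory.Automorphic.AlgebraicWeight`.
Definitions with bodies and theorems; no named fact, no instance, no `sorry`.

For a tame level `𝒰 : TameLevel n K p`:

* `GenIndex 𝒰`, `genElement 𝒰 : GenIndex 𝒰 → GL_n(𝔸_K^∞)` — the elements `t_{v,i}` (`v ∉ S`,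
  `i ≥ 0`) and `t_{v,n}⁻¹` whose Hecke families are `𝒰.heckeGenerators`
  (`range_heckeOperator_genElement`); their conjugation / double-coset / `p`-triviality data
  (`genElement_hconj`, `genElement_hbij`, `padicCoeffRep_genElement`) feeding the nilpotence and
  reduction files;
* `range_freeRingLift_eq_closure` (generic) and `range_genPoly`: the subring generated by
  `𝒰.heckeGenerators` is the image of the noncommutative polynomial ring under
  `genPoly 𝒰 = FreeRing.lift (𝒰.heckeOperator ∘ genElement)`;
* `genValue 𝒰 a` — the prospective values `a_{v,i}` (`a_{v,0} = 1`, `a_{v,i} = a_{v,min(i,n)}`,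
  `a(t_{v,n}⁻¹) = a_{v,n}⁻¹`) of a character on the generators, and
* **`characterOfKer`** — the ring homomorphism `x₀ : ℤ[heckeGenerators] → ℚ̄_p` with
  `x₀(Q(T)) = Q(a)` as soon as `Q(T) = 0 ⇒ Q(a) = 0` (`characterOfKer_apply_genPoly`,
  `characterOfKer_heckeOperator`).

This is the algebraic half of "the action of `𝕋_{K,cl}` on `ξ` gives a continuous map to `ℚ̄_p`"
in [Scholze2015, Cor. V.4.2]; continuity and the extension to the closure `𝕋(K^p)` are done
separately.

## References

* P. Scholze, *On torsion in the cohomology of locally symmetric varieties*, Ann. of Math. 182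
  (2015), §V.4, Thm. V.4.1 and Cor. V.4.2. [Scholze2015]
-/

noncomputable section

open IsDedekindDomain NumberField
open Literature.NumberTheory.Automorphic.BigHeckeGLn

namespace Literature.NumberTheory.Automorphic

/-! ### Generic: the image of the noncommutative polynomial ring -/

/-- **`im(FreeRing.lift f) = ℤ⟨range f⟩`**: the range of the evaluation of noncommutative
polynomials is the subring generated by the values. [folklore] -/
theorem range_freeRingLift_eq_closure {R : Type*} [Ring R] {I : Type*} (f : I → R) :
    (FreeRing.lift f).range = Subring.closure (Set.range f) := by
  apply le_antisymm
  · rintro _ ⟨Q, rfl⟩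
    induction Q using FreeRing.induction_on with
    | hn1 => rw [map_neg, map_one]; exact Subring.neg_mem _ (Subring.one_mem _)
    | hb i => rw [FreeRing.lift_of]; exact Subring.subset_closure ⟨i, rfl⟩
    | ha Q₁ Q₂ h₁ h₂ => rw [map_add]; exact Subring.add_mem _ h₁ h₂
    | hm Q₁ Q₂ h₁ h₂ => rw [map_mul]; exact Subring.mul_mem _ h₁ h₂
  · rw [Subring.closure_le]
    rintro _ ⟨i, rfl⟩
    exact ⟨FreeRing.of i, FreeRing.lift_of f i⟩

namespace AlgebraicWeight

variable {n : ℕ} {K : Type} [Field K] [NumberField K] {p : ℕ} [Fact p.Prime] (𝒰 : TameLevel n K p)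

/-! ### The generators -/

/-- Index set of the generators of `𝕋(K^p)`: pairs `(v, i)` (`v ∉ S`, `i ≥ 0`) for `T_{v,i}`, and
good places `v` for the inverse central operators `T_{v,n}⁻¹`. [folklore] -/
abbrev GenIndex : Type :=
  ({v : HeightOneSpectrum (𝓞 K) // v ∉ 𝒰.bad} × ℕ) ⊕ {v : HeightOneSpectrum (𝓞 K) // v ∉ 𝒰.bad}

/-- The group elements behind the generators: `t_{v,i}` and `t_{v,n}⁻¹`. [folklore] -/
def genElement : GenIndex 𝒰 → FiniteAdelicGL n K
  | Sum.inl vi => heckeElement n K vi.1 vi.2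
  | Sum.inr v => (heckeElement n K v n)⁻¹

/-- `genElement` on `(v, i)`. [folklore] -/
@[simp]
theorem genElement_inl (v : {v : HeightOneSpectrum (𝓞 K) // v ∉ 𝒰.bad}) (i : ℕ) :
    genElement 𝒰 (Sum.inl (v, i)) = heckeElement n K v i :=
  rfl

/-- `genElement` on `v` (inverse central element). [folklore] -/
@[simp]
theorem genElement_inr (v : {v : HeightOneSpectrum (𝓞 K) // v ∉ 𝒰.bad}) :
    genElement 𝒰 (Sum.inr v) = (heckeElement n K v n)⁻¹ :=
  rfl

/-- **The Hecke families of the `genElement`s are exactly `𝒰.heckeGenerators`.** [folklore] -/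
theorem range_heckeOperator_genElement :
    Set.range (fun i => 𝒰.heckeOperator (genElement 𝒰 i)) = 𝒰.heckeGenerators := by
  ext T
  constructor
  · rintro ⟨i, rfl⟩
    rcases i with ⟨v, i⟩ | v
    · exact Or.inl ⟨v, v.2, i, rfl⟩
    · exact Or.inr ⟨v, v.2, rfl⟩
  · rintro (⟨v, hv, i, rfl⟩ | ⟨v, hv, rfl⟩)
    · exact ⟨Sum.inl (⟨v, hv⟩, i), rfl⟩
    · exact ⟨Sum.inr ⟨v, hv⟩, rfl⟩

/-- `t_{v,n}⁻¹` commutes with everything. [folklore] -/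
theorem commute_heckeElement_self_inv (v : HeightOneSpectrum (𝓞 K)) (x : FiniteAdelicGL n K) :
    Commute (heckeElement n K v n)⁻¹ x :=
  Commute.inv_left (heckeElement_self_mul_comm v x)

/-- `t_{v,n}⁻¹` is central. [folklore] -/
theorem heckeElement_self_inv_mem_center (v : HeightOneSpectrum (𝓞 K)) :
    (heckeElement n K v n)⁻¹ ∈ Subgroup.center (FiniteAdelicGL n K) :=
  Subgroup.mem_center_iff.2 fun x => (commute_heckeElement_self_inv v x).eq.symm

/-- **`u tᵢ u⁻¹ ∈ U_r tᵢ U_r`** for the generators and `u ∈ U`. [folklore] -/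
theorem genElement_hconj (r : ℕ) (i : GenIndex 𝒰) (u : 𝒰.subgroup) :
    ∃ a ∈ 𝒰.tower r, ∃ b ∈ 𝒰.tower r,
      (u : FiniteAdelicGL n K) * genElement 𝒰 i * (u : FiniteAdelicGL n K)⁻¹ =
        a * genElement 𝒰 i * b := by
  rcases i with ⟨v, i⟩ | v
  · rw [genElement_inl]
    exact TameLevel.hconj_heckeElement 𝒰 r v.2 i u
  · refine ⟨1, one_mem _, 1, one_mem _, ?_⟩
    rw [one_mul, mul_one, genElement_inr, ← (commute_heckeElement_self_inv (v : HeightOneSpectrum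
      (𝓞 K)) (u : FiniteAdelicGL n K)).eq, mul_inv_cancel_right]

/-- For `z` commuting with `L`, `L' z L' / L' → L z L / L` is a bijection (both are singletons).
[folklore] -/
theorem bijOn_doubleCosetQuot_of_commute {L' L : Subgroup (FiniteAdelicGL n K)} (hle : L' ≤ L)
    {z : FiniteAdelicGL n K} (hz : ∀ x : FiniteAdelicGL n K, Commute z x) :
    Set.BijOn (Subgroup.quotientMapOfLE hle) (ArithmeticQuotient.doubleCosetQuot L' z)
      (ArithmeticQuotient.doubleCosetQuot L z) := by
  have hconj : ∀ (L₀ : Subgroup (FiniteAdelicGL n K)), ∀ l ∈ L₀, z⁻¹ * l * z ∈ L₀ :=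
    fun L₀ l hl => by
      have h : z⁻¹ * l * z = l := by
        rw [mul_assoc, ← (hz l).eq, ← mul_assoc, inv_mul_cancel, one_mul]
      rwa [h]
  rw [ArithmeticQuotient.doubleCosetQuot_eq_singleton_of_conj (hconj L'),
    ArithmeticQuotient.doubleCosetQuot_eq_singleton_of_conj (hconj L)]
  exact Set.bijOn_singleton.2 rfl

/-- **`U_r tᵢ U_r / U_r → U tᵢ U / U` is bijective** for the generators. [folklore] -/
theorem genElement_hbij (r : ℕ) (i : GenIndex 𝒰) :
    Set.BijOn (Subgroup.quotientMapOfLE (𝒰.tower_le r))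
      (ArithmeticQuotient.doubleCosetQuot (𝒰.tower r) (genElement 𝒰 i))
      (ArithmeticQuotient.doubleCosetQuot 𝒰.subgroup (genElement 𝒰 i)) := by
  rcases i with ⟨v, i⟩ | v
  · rw [genElement_inl]
    exact TameLevel.bijOn_subgroup_heckeElement v.2 i r
  · rw [genElement_inr]
    exact bijOn_doubleCosetQuot_of_commute (𝒰.tower_le r)
      (commute_heckeElement_self_inv (v : HeightOneSpectrum (𝓞 K)))

/-- **The generators act trivially on `V_λ(ℚ̄_p)`** (`π(tᵢ) = 1`: their components above `p` are
`1`, all places above `p` being in `S`). [folklore] -/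
theorem padicCoeffRep_genElement (lam : (K →+* PadicAlgCl p) → Fin n → ℤ) (i : GenIndex 𝒰) :
    ResGLnCohomology.padicCoeffRep n K p lam (genElement 𝒰 i) = 1 := by
  have hne : ∀ (v : {v : HeightOneSpectrum (𝓞 K) // v ∉ 𝒰.bad}) (w : HeightOneSpectrum (𝓞 K)),
      ((p : ℕ) : 𝓞 K) ∈ w.asIdeal → w ≠ (v : HeightOneSpectrum (𝓞 K)) :=
    fun v w hw h => v.2 (h ▸ 𝒰.mem_bad_of_mem w hw)
  rcases i with ⟨v, i⟩ | v
  · rw [genElement_inl]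
    exact ResGLnCohomology.padicCoeffRep_eq_one_of_localComponent_eq_one n K p lam fun w hw =>
      localComponent_heckeElement_of_ne (hne v w hw) i
  · rw [genElement_inr]
    exact ResGLnCohomology.padicCoeffRep_eq_one_of_localComponent_eq_one n K p lam fun w hw => by
      rw [map_inv, localComponent_heckeElement_of_ne (hne v w hw) n, inv_one]

/-! ### Polynomials in the generators -/

/-- Evaluation of noncommutative polynomials at the generator families. [folklore] -/
abbrev genPoly : FreeRing (GenIndex 𝒰) →+* 𝒰.bigEnd :=
  FreeRing.lift fun i => 𝒰.heckeOperator (genElement 𝒰 i)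

/-- **`ℤ[heckeGenerators] = im(genPoly)`.** [folklore] -/
theorem range_genPoly : (genPoly 𝒰).range = Subring.closure 𝒰.heckeGenerators := by
  rw [genPoly, range_freeRingLift_eq_closure, range_heckeOperator_genElement]

/-- Every element of `ℤ[heckeGenerators]` is a noncommutative polynomial in the generators.
[folklore] -/
theorem exists_genPoly_eq_of_mem_closure {T : 𝒰.bigEnd} (hT : T ∈ Subring.closure 𝒰.heckeGenerators) :
    ∃ Q, genPoly 𝒰 Q = T := by
  rw [← range_genPoly] at hT
  exact hT

/-- `genPoly Q ∈ ℤ[heckeGenerators]`. [folklore] -/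
theorem genPoly_mem_closure (Q : FreeRing (GenIndex 𝒰)) :
    genPoly 𝒰 Q ∈ Subring.closure 𝒰.heckeGenerators := by
  rw [← range_genPoly]
  exact ⟨Q, rfl⟩

/-! ### The values on the generators and the character `x₀` -/

/-- **The values `a(tᵢ)`** of a prospective character with `a(T_{v,i}) = a_{v,i}` (`1 ≤ i ≤ n`):
`a(T_{v,0}) = 1`, `a(T_{v,i}) = a_{v,min(i,n)}`, `a(T_{v,n}⁻¹) = a_{v,n}⁻¹`. [folklore] -/
def genValue (a : HeightOneSpectrum (𝓞 K) → ℕ → PadicAlgCl p) : GenIndex 𝒰 → PadicAlgCl p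
  | Sum.inl vi => if vi.2 = 0 then 1 else a vi.1 (min vi.2 n)
  | Sum.inr v => (a v n)⁻¹

/-- `genValue` on `(v, i)` with `1 ≤ i ≤ n`. [folklore] -/
theorem genValue_inl_of (a : HeightOneSpectrum (𝓞 K) → ℕ → PadicAlgCl p)
    (v : {v : HeightOneSpectrum (𝓞 K) // v ∉ 𝒰.bad}) {i : ℕ} (h1 : 1 ≤ i) (hn : i ≤ n) :
    genValue 𝒰 a (Sum.inl (v, i)) = a v i := by
  change (if i = 0 then 1 else a v (min i n)) = a v i
  rw [if_neg (by omega), min_eq_left hn]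

variable (a : HeightOneSpectrum (𝓞 K) → ℕ → PadicAlgCl p)

/-- The kernel condition as an inclusion of kernels along `rangeRestrict`. [folklore] -/
theorem ker_rangeRestrict_genPoly_le
    (hker : ∀ Q, genPoly 𝒰 Q = 0 → FreeRing.lift (genValue 𝒰 a) Q = 0) :
    RingHom.ker (genPoly 𝒰).rangeRestrict ≤ RingHom.ker (FreeRing.lift (genValue 𝒰 a)) := by
  intro Q hQ
  rw [RingHom.mem_ker] at hQ ⊢
  exact hker Q (congrArg Subtype.val hQ)

variable (hker : ∀ Q, genPoly 𝒰 Q = 0 → FreeRing.lift (genValue 𝒰 a) Q = 0)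

/-- **The character `x₀ : ℤ[heckeGenerators] → ℚ̄_p`, `Q(T) ↦ Q(a)`**, well defined as soon as
`Q(T) = 0 ⇒ Q(a) = 0`. [cite: Scholze2015, §V.4 (Cor. V.4.2: the action of 𝕋_{K,cl} on ξ)] -/
def characterOfKer : Subring.closure 𝒰.heckeGenerators →+* PadicAlgCl p :=
  (((genPoly 𝒰).rangeRestrict.liftOfSurjective (genPoly 𝒰).rangeRestrict_surjective)
      ⟨FreeRing.lift (genValue 𝒰 a), ker_rangeRestrict_genPoly_le 𝒰 a hker⟩).comp
    (RingEquiv.subringCongr (range_genPoly 𝒰).symm).toRingHom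

/-- **`x₀(Q(T)) = Q(a)`.** [folklore] -/
theorem characterOfKer_apply_genPoly (Q : FreeRing (GenIndex 𝒰)) :
    characterOfKer 𝒰 a hker ⟨genPoly 𝒰 Q, genPoly_mem_closure 𝒰 Q⟩ =
      FreeRing.lift (genValue 𝒰 a) Q := by
  have h : (RingEquiv.subringCongr (range_genPoly 𝒰).symm).toRingHom
      ⟨genPoly 𝒰 Q, genPoly_mem_closure 𝒰 Q⟩ = (genPoly 𝒰).rangeRestrict Q := rfl
  rw [characterOfKer, RingHom.comp_apply, h, RingHom.liftOfSurjective,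
    RingHom.liftOfRightInverse_comp_apply]

/-- `x₀` on an element of the closure written as a polynomial. [folklore] -/
theorem characterOfKer_apply_of_eq {T : Subring.closure 𝒰.heckeGenerators}
    {Q : FreeRing (GenIndex 𝒰)} (hQ : genPoly 𝒰 Q = T) :
    characterOfKer 𝒰 a hker T = FreeRing.lift (genValue 𝒰 a) Q := by
  have hT : T = ⟨genPoly 𝒰 Q, genPoly_mem_closure 𝒰 Q⟩ := Subtype.ext hQ.symm
  rw [hT, characterOfKer_apply_genPoly]

/-- **`x₀(T_{w,j}) = a_{w,j}`** for `w ∉ S`, `1 ≤ j ≤ n`. [folklore] -/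
theorem characterOfKer_heckeOperator {w : HeightOneSpectrum (𝓞 K)} (hw : w ∉ 𝒰.bad) {j : ℕ}
    (h1 : 1 ≤ j) (hn : j ≤ n) :
    characterOfKer 𝒰 a hker ⟨𝒰.heckeOperator (heckeElement n K w j),
        Subring.subset_closure (Or.inl ⟨w, hw, j, rfl⟩)⟩ = a w j := by
  rw [characterOfKer_apply_of_eq 𝒰 a hker (Q := FreeRing.of (Sum.inl (⟨w, hw⟩, j)))
      (FreeRing.lift_of _ _), FreeRing.lift_of]
  exact genValue_inl_of 𝒰 a ⟨w, hw⟩ h1 hn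

end AlgebraicWeight

end Literature.NumberTheory.Automorphic
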